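import Literature.NumberTheory.LFunctions.KloostermanSalie
import HarnessLib

/-!
# The Salié evaluation at a prime square: `S(a, b; p²) = p · Σ_{w² = ab} e(2w/p²)` — PROVED

Topic `Literature/NumberTheory/LFunctions` (exponential sums; fifth file on
`Literature.NumberTheory.LFunctions.kloostermanSum`). Cell `landau-siegel`, §D typer (edge fam):
this is P1 `SalieEvaluationSq` of the fam card `fam-nonresidue-square-tower`
(ls-knife-fam-idea-2, filed 2026-08-27T00:29Z), VERBATIM, as a kernel theorem
(`salieEvaluationSq`): for an odd prime `p` and units `a, b` modulo `p²`,
`S(a, b; p²) = p · Σ_{w ∈ ℤ/p²ℤ, w² = ab} e(2w/p²)` — the exact `p`-adic stationary phase at the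
first square modulus (Salié 1932; Iwaniec–Kowalski §12.3; Iwaniec, *Spectral methods* §2.5: the
roots `w² ≡ ab` are the critical points of the phase `x + ab x̄`, with value `2w`). The card's K2
(bilinear forms in modular square roots `w² ≡ ab (mod n²)`) reads the off-diagonal through it.

Proof (from the tree): `kloostermanSum_eq_one_mul` (`S(a,b) = S(1,ab)`) and the stationary-phase
identity `kloostermanSum_one_stationary` with `k = l = 1`:
`S(1, c; p²) = p · Σ_{u < p, p ∤ u, c ū² ≡ 1 (p)} e((u + c ū)/p²)`; the map `u ↦ w(u) = (u + c ū)/2`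
is a bijection from these `u` onto the square roots of `c` modulo `p²` (the Hensel lift of
`u mod p`: `(u + cū)² − 4c = (u − cū)² = u²(1 − cū²)² = 0` in `ℤ/p²ℤ`), with inverse
`w ↦ (w mod p)`, and by construction `2 w(u) = u + c ū`. No named fact.

«The programme SEARCHES and TYPES; no claim about Landau–Siegel zeros, Theorems 1–2 of
arXiv:2211.02515 or a repaired Margin232 until a kernel theorem says so.»

## References

* H. Salié, *Über die Kloostermanschen Summen S(u, v; q)*, Math. Z. 34 (1932) 91–109.
* [Iwaniec2002] H. Iwaniec, *Spectral Methods of Automorphic Forms*, 2nd ed. (2002), §2.5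
  (2.25) (Salié's bound; the evaluation is its proof at `q = p²`).
* H. Iwaniec, E. Kowalski, *Analytic Number Theory* (2004), §12.3 (Salié sums / stationary phase).
* Tree: `KloostermanPrimePowerTools` (`kloostermanSum_one_stationary`), `KloostermanSalie`.
-/

noncomputable section

open Finset

namespace Literature.NumberTheory.LFunctions

section PrimeSq

/-- `p ∣ p²` as `p¹ ∣ p²`. [folklore] -/
private theorem dvd12 {p : ℕ} : p ^ 1 ∣ p ^ 2 := pow_dvd_pow p (by norm_num)

variable {p : ℕ} [hp : Fact p.Prime]

/-- In `ℤ/p²ℤ` an element reducing to `0` modulo `p` has square `0`. [folklore] -/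
private theorem sq_eq_zero_of_castHom_eq_zero {y : ZMod (p ^ 2)}
    (hy : ZMod.castHom (dvd12 (p := p)) (ZMod (p ^ 1)) y = 0) : y ^ 2 = 0 := by
  obtain ⟨s, rfl⟩ := exists_eq_pow_mul_of_castHom_eq_zero _ hy
  have h0 : ((p : ℕ) : ZMod (p ^ 2)) ^ 2 = 0 := by
    have := ZMod.natCast_self (p ^ 2)
    push_cast at this
    exact this
  calc (((p ^ 1 : ℕ) : ZMod (p ^ 2)) * s) ^ 2 = ((p : ℕ) : ZMod (p ^ 2)) ^ 2 * s ^ 2 := by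
        push_cast; ring
    _ = 0 := by rw [h0, zero_mul]

/-- For odd `p`, `2` is invertible modulo `p²`: there is `t` with `2t = 1`. [folklore] -/
private theorem exists_two_mul_eq_one (hp2 : p ≠ 2) : ∃ t : ZMod (p ^ 2), 2 * t = 1 := by
  have hcop : Nat.Coprime 2 (p ^ 2) := by
    refine Nat.Coprime.pow_right 2 ?_
    exact (Nat.coprime_primes Nat.prime_two hp.out).mpr (Ne.symm hp2)
  refine ⟨((ZMod.unitOfCoprime 2 hcop)⁻¹ : (ZMod (p ^ 2))ˣ), ?_⟩
  have h := Units.mul_inv (ZMod.unitOfCoprime 2 hcop)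
  rwa [ZMod.coe_unitOfCoprime, Nat.cast_ofNat] at h

/-- **Salié's evaluation at `p²`** (P1 `SalieEvaluationSq` of the card
`fam-nonresidue-square-tower`, verbatim): for an odd prime `p` and units `a, b` modulo `p²`,
`S(a, b; p²) = p · Σ_{w ∈ ℤ/p²ℤ, w² = ab} e(2w/p²)`. [cite: Iwaniec2002, §2.5 (2.25)] -/
theorem salieEvaluationSq : ∀ (p : ℕ) [Fact p.Prime] [NeZero (p ^ 2)], p ≠ 2 →
    ∀ a b : ZMod (p ^ 2), IsUnit a → IsUnit b →
      kloostermanSum (p ^ 2) a b =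
        (p : ℂ) * ∑ w ∈ (Finset.univ.filter fun w : ZMod (p ^ 2) => w ^ 2 = a * b),
          (ZMod.stdAddChar (2 * w) : ℂ) := by
  intro p hp _ hp2 a b ha hb
  classical
  rw [kloostermanSum_eq_one_mul ha b]
  set c : ZMod (p ^ 2) := a * b with hc
  have hcu : IsUnit c := ha.mul hb
  obtain ⟨t, ht⟩ := exists_two_mul_eq_one (p := p) hp2
  have hp1 : p ^ 1 = p := pow_one p
  -- the stationary-phase identity with `k = l = 1`
  rw [kloostermanSum_one_stationary (p := p) (k := 1) (l := 1) (m := 2) (by norm_num) (by norm_num)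
    (Or.inr one_ne_zero) c]
  -- abbreviations
  set U : ℕ → ZMod (p ^ 2) := fun u => ((u : ℕ) : ZMod (p ^ 2)) with hU
  set π := ZMod.castHom (dvd12 (p := p)) (ZMod (p ^ 1)) with hπ
  set P : ℕ → Prop := fun u => IsUnit (U u) ∧ π (1 - c * (U u)⁻¹ ^ 2) = 0 with hP
  set wOf : ℕ → ZMod (p ^ 2) := fun u => (U u + c * (U u)⁻¹) * t with hwOf
  -- Step 1: the summand is `p · e(2 w(u))` on `P u` and `0` otherwise
  have hstep1 : ∀ u : ℕ,
      (if IsUnit (U u) then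
        (ZMod.stdAddChar (U u + c * (U u)⁻¹) : ℂ) *
          (if π (1 - c * (U u)⁻¹ ^ 2) = 0 then ((p ^ 1 : ℕ) : ℂ) else 0)
       else 0) = if P u then (p : ℂ) * (ZMod.stdAddChar (2 * wOf u) : ℂ) else 0 := by
    intro u
    by_cases hu : IsUnit (U u)
    · by_cases h0 : π (1 - c * (U u)⁻¹ ^ 2) = 0
      · have hPu : P u := ⟨hu, h0⟩
        rw [if_pos hu, if_pos h0, if_pos hPu, hp1]
        have h2w : 2 * wOf u = U u + c * (U u)⁻¹ := by
          simp only [hwOf]; linear_combination (U u + c * (U u)⁻¹) * ht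
        rw [h2w, mul_comm]
      · have hPu : ¬ P u := fun h => h0 h.2
        rw [if_pos hu, if_neg h0, if_neg hPu, mul_zero]
    · have hPu : ¬ P u := fun h => hu h.1
      rw [if_neg hu, if_neg hPu]
  have hsum1 : (∑ u ∈ range (p ^ 1), if IsUnit (U u) then
        (ZMod.stdAddChar (U u + c * (U u)⁻¹) : ℂ) *
          (if π (1 - c * (U u)⁻¹ ^ 2) = 0 then ((p ^ 1 : ℕ) : ℂ) else 0) else 0) =
      (p : ℂ) * ∑ u ∈ (range (p ^ 1)).filter P, (ZMod.stdAddChar (2 * wOf u) : ℂ) := by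
    rw [Finset.mul_sum, Finset.sum_filter]
    exact Finset.sum_congr rfl fun u _ => hstep1 u
  rw [show (∑ u ∈ range (p ^ 1), if IsUnit ((u : ℕ) : ZMod (p ^ 2)) then
        (ZMod.stdAddChar (((u : ℕ) : ZMod (p ^ 2)) + c * ((u : ℕ) : ZMod (p ^ 2))⁻¹) : ℂ) *
          (if ZMod.castHom (pow_dvd_pow p (show 1 ≤ 2 by norm_num)) (ZMod (p ^ 1))
              (1 - c * ((u : ℕ) : ZMod (p ^ 2))⁻¹ ^ 2) = 0
            then ((p ^ 1 : ℕ) : ℂ) else 0) else 0) =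
      (∑ u ∈ range (p ^ 1), if IsUnit (U u) then
        (ZMod.stdAddChar (U u + c * (U u)⁻¹) : ℂ) *
          (if π (1 - c * (U u)⁻¹ ^ 2) = 0 then ((p ^ 1 : ℕ) : ℂ) else 0) else 0) from rfl]
  rw [hsum1]
  congr 1
  -- Step 2: the bijection `u ↦ w(u)` onto the square roots of `c`
  -- algebraic facts
  have hsqc : ∀ u : ℕ, P u → (wOf u) ^ 2 = c := by
    rintro u ⟨hu, h0⟩
    have h1 : U u * (U u)⁻¹ = 1 := ZMod.mul_inv_of_unit _ hu
    have h2 : (1 - c * (U u)⁻¹ ^ 2) ^ 2 = 0 := sq_eq_zero_of_castHom_eq_zero h0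
    simp only [hwOf]
    linear_combination (t ^ 2 * U u ^ 2) * h2 +
      (t ^ 2 * (2 * U u * c * (U u)⁻¹ * (1 - c * (U u)⁻¹ ^ 2) +
        c ^ 2 * (U u)⁻¹ ^ 2 * (U u * (U u)⁻¹ - 1) + 4 * c)) * h1 + (c * (2 * t + 1)) * ht
  have hred : ∀ u : ℕ, P u → π (wOf u) = π (U u) := by
    rintro u ⟨hu, h0⟩
    have h1 : U u * (U u)⁻¹ = 1 := ZMod.mul_inv_of_unit _ hu
    have hdiff : wOf u - U u = -(c * (U u)⁻¹ * t) * 0 + (-(t * U u)) * (1 - c * (U u)⁻¹ ^ 2) := by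
      simp only [hwOf]
      linear_combination (U u) * ht - (c * (U u)⁻¹ * t) * h1
    have : π (wOf u - U u) = 0 := by
      rw [hdiff, map_add, map_mul, map_mul, h0, mul_zero, map_zero, mul_zero, add_zero]
    rwa [map_sub, sub_eq_zero] at this
  -- the maps
  refine Finset.sum_nbij' wOf (fun w => (π w).val) ?_ ?_ ?_ ?_ (fun u _ => rfl)
  · -- `w(u)` is a square root of `c`
    intro u hu
    have hu' : u ∈ (range (p ^ 1)).filter P := hu
    rw [Finset.mem_filter] at hu'
    show wOf u ∈ (Finset.univ.filter fun w : ZMod (p ^ 2) => w ^ 2 = c)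
    rw [Finset.mem_filter]
    exact ⟨Finset.mem_univ _, hsqc u hu'.2⟩
  · -- `(w mod p)` is an admissible `u`
    intro w hw
    have hw' : w ∈ (Finset.univ.filter fun w : ZMod (p ^ 2) => w ^ 2 = c) := hw
    rw [Finset.mem_filter] at hw'
    obtain ⟨-, hw2⟩ := hw'
    show (π w).val ∈ (range (p ^ 1)).filter P
    rw [Finset.mem_filter]
    have hwu : IsUnit w := by
      have : IsUnit (w ^ 2) := by rw [hw2]; exact hcu
      exact (isUnit_pow_iff two_ne_zero).mp this
    set n : ℕ := (π w).val with hn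
    have hnlt : n < p ^ 1 := ZMod.val_lt _
    have hπn : π (U n) = π w := by
      simp only [hU, map_natCast, hn, ZMod.natCast_zmod_val]
    have hπw : IsUnit (π w) := hwu.map π
    have hUn : IsUnit (U n) := by
      simp only [hU]
      rw [isUnit_natCast_iff_not_dvd (p := p) two_ne_zero]
      intro hdvd
      have h0 : π (U n) = 0 := by
        simp only [hU, map_natCast, ZMod.natCast_eq_zero_iff, pow_one]
        exact hdvd
      rw [hπn] at h0
      haveI : Fact (1 < p ^ 1) := ⟨by rw [pow_one]; exact hp.out.one_lt⟩
      exact hπw.ne_zero h0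
    refine ⟨Finset.mem_range.mpr hnlt, hUn, ?_⟩
    -- the congruence `c ū² ≡ 1 (mod p)`
    have hπc : π c = π w ^ 2 := by rw [← map_pow, hw2]
    have hinv : π ((U n)⁻¹) = (π w)⁻¹ := by
      have h1 : π ((U n)⁻¹) = (π (U n))⁻¹ := by
        simp only [hπ, ZMod.castHom_apply]
        exact ZMod.cast_inv_of_isUnit dvd12 hUn
      rw [h1, hπn]
    have hω : π w * (π w)⁻¹ = 1 := ZMod.mul_inv_of_unit _ hπw
    rw [map_sub, map_one, map_mul, map_pow, hπc, hinv]
    linear_combination (-(1 + π w * (π w)⁻¹)) * hω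
  · -- left inverse: `(w(u) mod p) = u`
    intro u hu
    have hu' : u ∈ (range (p ^ 1)).filter P := hu
    rw [Finset.mem_filter, Finset.mem_range] at hu'
    obtain ⟨hult, hPu⟩ := hu'
    show (π (wOf u)).val = u
    rw [hred u hPu]
    simp only [hU, map_natCast, ZMod.val_natCast]
    exact Nat.mod_eq_of_lt hult
  · -- right inverse: `w((w mod p)) = w`
    intro w hw
    have hw' : w ∈ (Finset.univ.filter fun w : ZMod (p ^ 2) => w ^ 2 = c) := hw
    rw [Finset.mem_filter] at hw'
    obtain ⟨-, hw2⟩ := hw'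
    have hwu : IsUnit w := by
      have : IsUnit (w ^ 2) := by rw [hw2]; exact hcu
      exact (isUnit_pow_iff two_ne_zero).mp this
    set n : ℕ := (π w).val with hn
    have hπn : π (U n) = π w := by
      simp only [hU, map_natCast, hn, ZMod.natCast_zmod_val]
    have hUn : IsUnit (U n) := by
      simp only [hU]
      rw [isUnit_natCast_iff_not_dvd (p := p) two_ne_zero]
      intro hdvd
      have h0 : π (U n) = 0 := by
        simp only [hU, map_natCast, ZMod.natCast_eq_zero_iff, pow_one]
        exact hdvd
      rw [hπn] at h0
      haveI : Fact (1 < p ^ 1) := ⟨by rw [pow_one]; exact hp.out.one_lt⟩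
      exact (hwu.map π).ne_zero h0
    have h1 : U n * (U n)⁻¹ = 1 := ZMod.mul_inv_of_unit _ hUn
    have h4 : (U n - w) ^ 2 = 0 := by
      refine sq_eq_zero_of_castHom_eq_zero ?_
      rw [map_sub, sub_eq_zero]
      exact hπn
    show wOf n = w
    simp only [hwOf]
    rw [← hw2]
    linear_combination (t * (U n)⁻¹) * h4 + (-(t * (U n - 2 * w))) * h1 + w * ht

end PrimeSq

end Literature.NumberTheory.LFunctions

end
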